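import Summits.BirchSwinnertonDyer.BirchSwinnertonDyer.Theorems.KolyvaginDepthDoorDepthTableRowKitOfPrint
import Summits.BirchSwinnertonDyer.BirchSwinnertonDyer.Theorems.KolyvaginDepthDoorDepthTableRows1
import Summits.BirchSwinnertonDyer.BirchSwinnertonDyer.Theorems.KolyvaginDepthDoorDepthTableRows4
import Summits.BirchSwinnertonDyer.BirchSwinnertonDyer.Theorems.KolyvaginDepthDoorDepthTableOddPrimeKit
import Summits.BirchSwinnertonDyer.BirchSwinnertonDyer.Theorems.Rank1ResidualIntModelReduction
import Literature.NumberTheory.EllipticCurves.ComplexMultiplicationNotSemistable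
import HarnessLib

/-!
# Route `KolyvaginDepthDoor` — DEPTH-TABLE rows `389a1` `(5, −7, 19)`, `709a1` `(5, −7, 409)`,
# `718b1` `(5, −7, 59)` WITHOUT Kolyvagin's structure theorem (crux `KolyvaginDepthSupply`,
# stmt-BirchSwinnertonDyer-21765) — the three Jetchev–Lauter–Stein calibration curves

Helper file (`--supports stmt-BirchSwinnertonDyer-21765 --as helper`); it closes nothing and BSD is
not proved by it.

The table's first row, `C389a1.depthRow_5_neg7_19` (file `…DepthTableRows1`), is conditional on
`hF = Kolyvagin1991_selmerCorank_of_kolyvaginClass_ne_zero` (Kolyvagin 1991 Thm. 4, XL). This file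
rewrites it over the row kit WITHOUT `hF` (`depthRow_of_print_of_intModel_certificate`, file
`…DepthTableRowKitOfPrint`; engine: the minimal-depth descent proved in
`Literature…HeegnerPointsKolyvaginDepthDescent`), discharging in the kernel the two extra side
conditions that kit asks for:

* `C389a1.hasSurjectiveModNGaloisRep_pow_5` — `5 ∈ B(389a1)`: `ρ̄_{E,5^m}` onto for every `m`
  (semistable, `X² − a_3 X + 3` root-free mod `5`, the multiplicative prime `389 ∥ Δ` with `5 ∤ 1`;
  `hasSurjectiveModNGaloisRep_pow_of_intModel_certificate` of `…OddPrimeKit`);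
* `C389a1.not_hasCM'` — `389a1` is not CM (multiplicative reduction at `389`; a CM curve has
  integral `j`), for the `Curve389a1.E` spelling of the curve used by the row files;
* `C389a1.depthRow_5_neg7_19_of_print` — **THE ROW WITHOUT `hF`**: for ANY imaginary quadratic `K`
  with `d_K = −7`, any frame `(Dt, β, ι)` and any COMPATIBLE system `d n` of Kolyvagin–Heegner data
  (McCallum's one system of choices), granted the five named McCallum/Gross leaves
  (`sign_conjAct_kolyvaginClass`, `lemma43_kolyvaginClass_mem_selmerLocalKer`,
  `prop44_localOrder_kolyvaginClass_mul_eq`, `lemma53_selmer_eigen_dependent_at`,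
  `prop22_reciprocity_eigen_finset`): IF `c_1(19) ≠ 0` (the bit of the row; JLS cost
  `[K[19] : K] = 20`) and the twist `E^{(−7)}` has a rational point of infinite order, THEN
  `corank_{ℤ_5} Ш(E)[5^∞] = 0`, `rank_ℤ E(ℚ) = 2`, `rank_ℤ E^{(−7)}(ℚ) = 1`,
  `corank_{ℤ_5} Ш(E^{(−7)})[5^∞] = 0`. Every other side condition (surjectivity tower, non-CM,
  Heegner hypothesis, Kolyvagin prime, `2 ≤ rank`) is a kernel theorem.

* `C709a1.depthRow_5_neg7_409_of_print`, `C718b1.depthRow_5_neg7_59_of_print` — the same for the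
  rows `709a1` (`ℓ = 409`) and `718b1` (`ℓ = 59`) of `…DepthTableRows4` (tower surjectivity at `5`
  from the multiplicative primes `709 ∥ Δ`, `359 ∥ Δ`; non-CM likewise).

Honest comparison with the hF-rows: traded Kolyvagin Thm. 4 (XL) for five S/M leaves + the SYSTEM of
data (not one datum) + one twist point (the hF-row derives `corank Sel_{5^∞}(E^{(−7)}) = 1` instead).
Per-curve; BSD is not proved by it.
-/

set_option linter.dupNamespace false

noncomputable section

open scoped Classical NumberField

namespace Summit.BirchSwinnertonDyer.BirchSwinnertonDyer.Theorems.KolyvaginDepthDoor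

open Literature.NumberTheory.EllipticCurves Literature.NumberTheory.EllipticCurves.ModularForms
  Literature.NumberTheory.EllipticCurves.McCallum1991 WeierstrassCurve
open Summit.BirchSwinnertonDyer.BirchSwinnertonDyer.Rank2Observatory
open Summit.BirchSwinnertonDyer.BirchSwinnertonDyer.Rank1Residual

namespace C389a1

/-- **`5 ∈ B(389a1)`: `ρ̄_{E,5^m}` is onto for every `m`** (unconditional): semistable
(`gcd(c₄, Δ) = 1`), `X² − a_3 X + 3` with `a_3 = −2` root-free mod `5` (`E[5]` irreducible, Mazur
6.3; onto, Serre Prop. 21), and the multiplicative prime `389 ∥ Δ` with `5 ∤ 1` (a transvection lifts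
the image to `GL₂(ℤ/5^m)`). [cite: Serre1972, §5.4 Prop. 21] [cite: SerreAbelianLadic1968, Ch. IV §3.4] -/
theorem hasSurjectiveModNGaloisRep_pow_5 (m : ℕ) :
    Curve389a1.E.HasSurjectiveModNGaloisRep (5 ^ m : ℕ) := by
  have hn : ∀ t : ZMod 5, t ^ 2 - (((3 : ℕ) : ℤ) + 1 - (6 : ℕ) : ℤ) * t + ((3 : ℕ) : ZMod 5) ≠ 0 := by
    decide +kernel
  haveI := Fact.mk (by norm_num : Nat.Prime 5)
  haveI := Fact.mk (by norm_num : Nat.Prime 3)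
  haveI := curve389a1_isGloballyMinimal
  exact hasSurjectiveModNGaloisRep_pow_of_intModel_certificate intModel
    (by rw [Int.isCoprime_iff_gcd_eq_one]; decide +kernel) 5 3 (by norm_num) (by decide +kernel)
    (n := 6) card_3 hn 389 (by norm_num) (by norm_num) (by decide +kernel) (by decide +kernel)
    (e := 1) (by decide +kernel) (by decide +kernel) (by decide +kernel) m

/-- **`389a1` (as `Curve389a1.E`) is not CM** (unconditional): multiplicative reduction at `389`
(`389 ∣ Δ = 389`, `389 ∤ c₄ = 112`), while a CM curve over `ℚ` has no multiplicative prime (integral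
`j`). Same argument as `C389a1.AtThree.not_hasCM` for the other spelling of the curve.
[cite: SilvermanATAEC1994, Thm. II.6.4 (PDF p. 148)] [cite: CremonaAlgorithms1997, Table 1 (389a1)] -/
theorem not_hasCM' : ¬ Curve389a1.E.HasCM := by
  haveI := curve389a1_isGloballyMinimal
  haveI := Fact.mk (by norm_num : Nat.Prime 389)
  intro hCM
  exact not_hasMultiplicativeReductionAtPrime_of_hasCM _ hCM 389
    (IntModel.hasMultiplicativeReductionAtPrime_of_intModel intModel 389 (by decide +kernel)
      (by decide +kernel))

/-- **DEPTH-TABLE ROW `389a1`, `(p, d_K, ℓ) = (5, −7, 19)`, WITHOUT Kolyvagin's structure theorem.**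
For `E = 389a1`, ANY imaginary quadratic `K` with `d_K = −7`, any frame `(Dt, β, ι)` and any
COMPATIBLE system `d n` of Kolyvagin–Heegner data over it (`hσ`, `hS₁`, `hS₂`, `hemb`), granted the
five named leaves (Gross Prop. 5.4 (2); McCallum Lemma 4.3, Prop. 4.4, Lemma 5.3, Prop. 2.2): IF the
first derived class at the Kolyvagin prime `19` does not vanish, `(d 19).kolyvaginClass _ 1 ≠ 0`, and
`E^{(−7)}` has a rational point of infinite order (`1 ≤ rank`), THEN `corank_{ℤ_5} Ш(E)[5^∞] = 0`,
`rank_ℤ E(ℚ) = 2`, `rank_ℤ E^{(−7)}(ℚ) = 1` and `corank_{ℤ_5} Ш(E^{(−7)})[5^∞] = 0`. All side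
conditions are kernel theorems (`hasSurjectiveModNGaloisRep_pow_5`, `not_hasCM'`, `heegner_neg7`,
`card_19`, `Curve389a1.two_le_mordellWeilRank`). CONDITIONAL on the five facts, the bit and the
twist point; per-curve; BSD is not proved by it. [cite: Kolyvagin1991MathAnn, Thm. 2.3]
[cite: McCallumLMS1991, §§2–5] [cite: JetchevLauterStein2009, §3.6 (arXiv:0707.0032)] -/
theorem depthRow_5_neg7_19_of_print
    (h54 : sign_conjAct_kolyvaginClass) (h43 : lemma43_kolyvaginClass_mem_selmerLocalKer)
    (h44 : prop44_localOrder_kolyvaginClass_mul_eq) (h53 : lemma53_selmer_eigen_dependent_at)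
    (h22 : prop22_reciprocity_eigen_finset)
    (K : Type) [Field K] [NumberField K] (hK : IsImaginaryQuadratic K)
    (hD : NumberField.discr K = -7) :
    haveI := curve389a1_isGloballyMinimal;
    haveI := curve389a1_neZero_conductorNorm;
    ∀ (Dt : ModularParametrizationData Curve389a1.E (Curve389a1.E.conductorNorm ℤ)) (β : ℤ)
      (ι : K →+* ℂ) (d : ∀ m : ℕ, KolyvaginHeegnerData Dt β ι m),
    (∀ (m l : ℕ), ∀ l' ∈ m.primeFactors, ∀ (x : ringClassField K ι m)
      (x' : ringClassField K ι (m * l)),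
      (x : ℂ) = x' → (((d (m * l)).σ l' x' : ringClassField K ι (m * l)) : ℂ) = ((d m).σ l' x : ℂ)) →
    (∀ (m l : ℕ), ∀ s ∈ (d m).S, ∃ s' ∈ (d (m * l)).S, ∀ (x : ringClassField K ι m)
      (x' : ringClassField K ι (m * l)),
      (x : ℂ) = x' → ((s' x' : ringClassField K ι (m * l)) : ℂ) = (s x : ℂ)) →
    (∀ (m l : ℕ), ∀ s' ∈ (d (m * l)).S, ∃ s ∈ (d m).S, ∀ (x : ringClassField K ι m)
      (x' : ringClassField K ι (m * l)),
      (x : ℂ) = x' → ((s' x' : ringClassField K ι (m * l)) : ℂ) = (s x : ℂ)) →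
    (∀ (m l : ℕ) (x : ringClassField K ι m) (x' : ringClassField K ι (m * l)),
      (x : ℂ) = x' → (d (m * l)).emb x' = (d m).emb x) →
    (d 19).kolyvaginClass (p := 5) (by norm_num) 1 ≠ 0 →
    1 ≤ (Curve389a1.E.quadraticTwist ((-7 : ℤ) : ℚ)).mordellWeilRank →
    Curve389a1.E.shaCorank 5 = 0 ∧ Curve389a1.E.mordellWeilRank = 2 ∧
      (Curve389a1.E.quadraticTwist ((-7 : ℤ) : ℚ)).mordellWeilRank = 1 ∧
      (Curve389a1.E.quadraticTwist ((-7 : ℤ) : ℚ)).shaCorank 5 = 0 := by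
  haveI := curve389a1_isGloballyMinimal
  haveI := curve389a1_neZero_conductorNorm
  intro Dt β ι d hσ hS₁ hS₂ hemb hne htw
  haveI := Fact.mk (by norm_num : Nat.Prime 5)
  exact depthRow_of_print_of_intModel_certificate intModel h54 h43 h44 h53 h22 not_hasCM'
    Curve389a1.two_le_mordellWeilRank 5 (by norm_num) hasSurjectiveModNGaloisRep_pow_5 K hK hD
    (by norm_num) (by norm_num) heegner_neg7 19 (by norm_num) (by norm_num) (by decide +kernel)
    (by norm_num) (by norm_num) (by norm_num) (by norm_num) (n := 15) card_19 (by norm_num) Dt β ι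
    d hσ hS₁ hS₂ hemb hne htw

end C389a1

/-! ## Row `709a1` = `[0,-1,1,-2,0]` (`N = Δ = 709`): `(p, d_K, ℓ) = (5, −7, 409)` -/

namespace C709a1

/-- **`5 ∈ B(709a1)`: `ρ̄_{E,5^m}` onto for every `m`** (semistable; `X² − a_7 X + 7`, `a_7 = −4`,
root-free mod `5`; multiplicative prime `709 ∥ Δ`, `5 ∤ 1`). [cite: Serre1972, §5.4 Prop. 21]
[cite: SerreAbelianLadic1968, Ch. IV §3.4] -/
theorem hasSurjectiveModNGaloisRep_pow_5 (m : ℕ) :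
    ((⟨0, -1, 1, -2, 0⟩ : WeierstrassCurve ℤ).map (Int.castRingHom ℚ)).HasSurjectiveModNGaloisRep
      (5 ^ m : ℕ) := by
  have hn : ∀ t : ZMod 5, t ^ 2 - (((7 : ℕ) : ℤ) + 1 - (12 : ℕ) : ℤ) * t + ((7 : ℕ) : ZMod 5) ≠ 0 := by
    decide +kernel
  haveI := Fact.mk (by norm_num : Nat.Prime 5)
  haveI := Fact.mk (by norm_num : Nat.Prime 7)
  haveI := isElliptic_c709a1
  haveI := isGloballyMinimal_c709a1
  exact hasSurjectiveModNGaloisRep_pow_of_intModel_certificate intModel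
    (by rw [Int.isCoprime_iff_gcd_eq_one]; decide +kernel) 5 7 (by norm_num) (by decide +kernel)
    (n := 12) card_7 hn 709 (by norm_num) (by norm_num) (by decide +kernel) (by decide +kernel)
    (e := 1) (by decide +kernel) (by decide +kernel) (by decide +kernel) m

/-- **`709a1` is not CM** (multiplicative reduction at `709`; a CM curve has integral `j`).
[cite: SilvermanATAEC1994, Thm. II.6.4 (PDF p. 148)] [cite: CremonaAlgorithms1997, Table 1 (709a1)] -/
theorem not_hasCM :
    haveI := isElliptic_c709a1;
    ¬ ((⟨0, -1, 1, -2, 0⟩ : WeierstrassCurve ℤ).map (Int.castRingHom ℚ)).HasCM := by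
  haveI := isElliptic_c709a1
  haveI := isGloballyMinimal_c709a1
  haveI := Fact.mk (by norm_num : Nat.Prime 709)
  intro hCM
  exact not_hasMultiplicativeReductionAtPrime_of_hasCM _ hCM 709
    (IntModel.hasMultiplicativeReductionAtPrime_of_intModel intModel 709 (by decide +kernel)
      (by decide +kernel))

/-- **DEPTH-TABLE ROW `709a1`, `(p, d_K, ℓ) = (5, −7, 409)`, WITHOUT Kolyvagin's structure theorem**:
for ANY imaginary quadratic `K` with `d_K = −7`, any frame and any COMPATIBLE system `d n` of
Kolyvagin–Heegner data, granted the five named McCallum/Gross leaves: the bit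
`(d 409).kolyvaginClass _ 1 ≠ 0` and one rational point of infinite order on `E^{(−7)}` give
`corank_{ℤ_5} Ш(E)[5^∞] = 0`, `rank_ℤ E(ℚ) = 2`, `rank_ℤ E^{(−7)}(ℚ) = 1`,
`corank_{ℤ_5} Ш(E^{(−7)})[5^∞] = 0`; every side condition is a kernel theorem. CONDITIONAL on the
five facts, the bit, the twist point; per-curve; BSD is not proved by it.
[cite: Kolyvagin1991MathAnn, Thm. 2.3] [cite: McCallumLMS1991, §§2–5]
[cite: JetchevLauterStein2009, §3.6 (arXiv:0707.0032)] -/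
theorem depthRow_5_neg7_409_of_print
    (h54 : sign_conjAct_kolyvaginClass) (h43 : lemma43_kolyvaginClass_mem_selmerLocalKer)
    (h44 : prop44_localOrder_kolyvaginClass_mul_eq) (h53 : lemma53_selmer_eigen_dependent_at)
    (h22 : prop22_reciprocity_eigen_finset)
    (K : Type) [Field K] [NumberField K] (hK : IsImaginaryQuadratic K)
    (hD : NumberField.discr K = -7) :
    haveI := isElliptic_c709a1;
    haveI := isGloballyMinimal_c709a1;
    haveI : NeZero (((⟨0, -1, 1, -2, 0⟩ : WeierstrassCurve ℤ).map (Int.castRingHom ℚ)).conductorNorm ℤ) :=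
      neZero_conductorNorm_of_isElliptic _;
    ∀ (Dt : ModularParametrizationData ((⟨0, -1, 1, -2, 0⟩ : WeierstrassCurve ℤ).map (Int.castRingHom ℚ))
        (((⟨0, -1, 1, -2, 0⟩ : WeierstrassCurve ℤ).map (Int.castRingHom ℚ)).conductorNorm ℤ)) (β : ℤ)
      (ι : K →+* ℂ) (d : ∀ m : ℕ, KolyvaginHeegnerData Dt β ι m),
    (∀ (m l : ℕ), ∀ l' ∈ m.primeFactors, ∀ (x : ringClassField K ι m)
      (x' : ringClassField K ι (m * l)),
      (x : ℂ) = x' → (((d (m * l)).σ l' x' : ringClassField K ι (m * l)) : ℂ) = ((d m).σ l' x : ℂ)) →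
    (∀ (m l : ℕ), ∀ s ∈ (d m).S, ∃ s' ∈ (d (m * l)).S, ∀ (x : ringClassField K ι m)
      (x' : ringClassField K ι (m * l)),
      (x : ℂ) = x' → ((s' x' : ringClassField K ι (m * l)) : ℂ) = (s x : ℂ)) →
    (∀ (m l : ℕ), ∀ s' ∈ (d (m * l)).S, ∃ s ∈ (d m).S, ∀ (x : ringClassField K ι m)
      (x' : ringClassField K ι (m * l)),
      (x : ℂ) = x' → ((s' x' : ringClassField K ι (m * l)) : ℂ) = (s x : ℂ)) →
    (∀ (m l : ℕ) (x : ringClassField K ι m) (x' : ringClassField K ι (m * l)),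
      (x : ℂ) = x' → (d (m * l)).emb x' = (d m).emb x) →
    (d 409).kolyvaginClass (p := 5) (by norm_num) 1 ≠ 0 →
    1 ≤ (((⟨0, -1, 1, -2, 0⟩ : WeierstrassCurve ℤ).map (Int.castRingHom ℚ)).quadraticTwist
      ((-7 : ℤ) : ℚ)).mordellWeilRank →
    ((⟨0, -1, 1, -2, 0⟩ : WeierstrassCurve ℤ).map (Int.castRingHom ℚ)).shaCorank 5 = 0 ∧
      ((⟨0, -1, 1, -2, 0⟩ : WeierstrassCurve ℤ).map (Int.castRingHom ℚ)).mordellWeilRank = 2 ∧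
      (((⟨0, -1, 1, -2, 0⟩ : WeierstrassCurve ℤ).map (Int.castRingHom ℚ)).quadraticTwist
        ((-7 : ℤ) : ℚ)).mordellWeilRank = 1 ∧
      (((⟨0, -1, 1, -2, 0⟩ : WeierstrassCurve ℤ).map (Int.castRingHom ℚ)).quadraticTwist
        ((-7 : ℤ) : ℚ)).shaCorank 5 = 0 := by
  haveI := isElliptic_c709a1
  haveI := isGloballyMinimal_c709a1
  haveI : NeZero (((⟨0, -1, 1, -2, 0⟩ : WeierstrassCurve ℤ).map (Int.castRingHom ℚ)).conductorNorm ℤ) :=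
    neZero_conductorNorm_of_isElliptic _
  intro Dt β ι d hσ hS₁ hS₂ hemb hne htw
  haveI := Fact.mk (by norm_num : Nat.Prime 5)
  exact depthRow_of_print_of_intModel_certificate intModel h54 h43 h44 h53 h22 not_hasCM
    KernelCerts002.C709a1.two_le_rank 5 (by norm_num) hasSurjectiveModNGaloisRep_pow_5 K hK hD
    (by norm_num) (by norm_num) heegner_neg7 409 (by norm_num) (by norm_num) (by decide +kernel)
    (by norm_num) (by norm_num) (by norm_num) (by norm_num) (n := 405) card_409 (by norm_num) Dt β ι
    d hσ hS₁ hS₂ hemb hne htw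

end C709a1

/-! ## Row `718b1` = `[1,0,1,-5,0]` (`N = 718`, `Δ = 5744 = 2⁴·359`): `(p, d_K, ℓ) = (5, −7, 59)` -/

namespace C718b1

/-- **`5 ∈ B(718b1)`: `ρ̄_{E,5^m}` onto for every `m`** (semistable; `X² − a_3 X + 3`, `a_3 = −2`,
root-free mod `5`; multiplicative prime `359 ∥ Δ`, `5 ∤ 1`). [cite: Serre1972, §5.4 Prop. 21]
[cite: SerreAbelianLadic1968, Ch. IV §3.4] -/
theorem hasSurjectiveModNGaloisRep_pow_5 (m : ℕ) :
    ((⟨1, 0, 1, -5, 0⟩ : WeierstrassCurve ℤ).map (Int.castRingHom ℚ)).HasSurjectiveModNGaloisRep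
      (5 ^ m : ℕ) := by
  have hn : ∀ t : ZMod 5, t ^ 2 - (((3 : ℕ) : ℤ) + 1 - (6 : ℕ) : ℤ) * t + ((3 : ℕ) : ZMod 5) ≠ 0 := by
    decide +kernel
  haveI := Fact.mk (by norm_num : Nat.Prime 5)
  haveI := Fact.mk (by norm_num : Nat.Prime 3)
  haveI := isElliptic_c718b1
  haveI := isGloballyMinimal_c718b1
  exact hasSurjectiveModNGaloisRep_pow_of_intModel_certificate intModel
    (by rw [Int.isCoprime_iff_gcd_eq_one]; decide +kernel) 5 3 (by norm_num) (by decide +kernel)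
    (n := 6) card_3 hn 359 (by norm_num) (by norm_num) (by decide +kernel) (by decide +kernel)
    (e := 1) (by decide +kernel) (by decide +kernel) (by decide +kernel) m

/-- **`718b1` is not CM** (multiplicative reduction at `359`; a CM curve has integral `j`).
[cite: SilvermanATAEC1994, Thm. II.6.4 (PDF p. 148)] [cite: CremonaAlgorithms1997, Table 1 (718b1)] -/
theorem not_hasCM :
    haveI := isElliptic_c718b1;
    ¬ ((⟨1, 0, 1, -5, 0⟩ : WeierstrassCurve ℤ).map (Int.castRingHom ℚ)).HasCM := by
  haveI := isElliptic_c718b1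
  haveI := isGloballyMinimal_c718b1
  haveI := Fact.mk (by norm_num : Nat.Prime 359)
  intro hCM
  exact not_hasMultiplicativeReductionAtPrime_of_hasCM _ hCM 359
    (IntModel.hasMultiplicativeReductionAtPrime_of_intModel intModel 359 (by decide +kernel)
      (by decide +kernel))

/-- **DEPTH-TABLE ROW `718b1`, `(p, d_K, ℓ) = (5, −7, 59)`, WITHOUT Kolyvagin's structure theorem**:
for ANY imaginary quadratic `K` with `d_K = −7`, any frame and any COMPATIBLE system `d n` of
Kolyvagin–Heegner data, granted the five named McCallum/Gross leaves: the bit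
`(d 59).kolyvaginClass _ 1 ≠ 0` and one rational point of infinite order on `E^{(−7)}` give
`corank_{ℤ_5} Ш(E)[5^∞] = 0`, `rank_ℤ E(ℚ) = 2`, `rank_ℤ E^{(−7)}(ℚ) = 1`,
`corank_{ℤ_5} Ш(E^{(−7)})[5^∞] = 0`; every side condition is a kernel theorem. CONDITIONAL on the
five facts, the bit, the twist point; per-curve; BSD is not proved by it.
[cite: Kolyvagin1991MathAnn, Thm. 2.3] [cite: McCallumLMS1991, §§2–5]
[cite: JetchevLauterStein2009, §3.6 (arXiv:0707.0032)] -/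
theorem depthRow_5_neg7_59_of_print
    (h54 : sign_conjAct_kolyvaginClass) (h43 : lemma43_kolyvaginClass_mem_selmerLocalKer)
    (h44 : prop44_localOrder_kolyvaginClass_mul_eq) (h53 : lemma53_selmer_eigen_dependent_at)
    (h22 : prop22_reciprocity_eigen_finset)
    (K : Type) [Field K] [NumberField K] (hK : IsImaginaryQuadratic K)
    (hD : NumberField.discr K = -7) :
    haveI := isElliptic_c718b1;
    haveI := isGloballyMinimal_c718b1;
    haveI : NeZero (((⟨1, 0, 1, -5, 0⟩ : WeierstrassCurve ℤ).map (Int.castRingHom ℚ)).conductorNorm ℤ) :=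
      neZero_conductorNorm_of_isElliptic _;
    ∀ (Dt : ModularParametrizationData ((⟨1, 0, 1, -5, 0⟩ : WeierstrassCurve ℤ).map (Int.castRingHom ℚ))
        (((⟨1, 0, 1, -5, 0⟩ : WeierstrassCurve ℤ).map (Int.castRingHom ℚ)).conductorNorm ℤ)) (β : ℤ)
      (ι : K →+* ℂ) (d : ∀ m : ℕ, KolyvaginHeegnerData Dt β ι m),
    (∀ (m l : ℕ), ∀ l' ∈ m.primeFactors, ∀ (x : ringClassField K ι m)
      (x' : ringClassField K ι (m * l)),
      (x : ℂ) = x' → (((d (m * l)).σ l' x' : ringClassField K ι (m * l)) : ℂ) = ((d m).σ l' x : ℂ)) →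
    (∀ (m l : ℕ), ∀ s ∈ (d m).S, ∃ s' ∈ (d (m * l)).S, ∀ (x : ringClassField K ι m)
      (x' : ringClassField K ι (m * l)),
      (x : ℂ) = x' → ((s' x' : ringClassField K ι (m * l)) : ℂ) = (s x : ℂ)) →
    (∀ (m l : ℕ), ∀ s' ∈ (d (m * l)).S, ∃ s ∈ (d m).S, ∀ (x : ringClassField K ι m)
      (x' : ringClassField K ι (m * l)),
      (x : ℂ) = x' → ((s' x' : ringClassField K ι (m * l)) : ℂ) = (s x : ℂ)) →
    (∀ (m l : ℕ) (x : ringClassField K ι m) (x' : ringClassField K ι (m * l)),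
      (x : ℂ) = x' → (d (m * l)).emb x' = (d m).emb x) →
    (d 59).kolyvaginClass (p := 5) (by norm_num) 1 ≠ 0 →
    1 ≤ (((⟨1, 0, 1, -5, 0⟩ : WeierstrassCurve ℤ).map (Int.castRingHom ℚ)).quadraticTwist
      ((-7 : ℤ) : ℚ)).mordellWeilRank →
    ((⟨1, 0, 1, -5, 0⟩ : WeierstrassCurve ℤ).map (Int.castRingHom ℚ)).shaCorank 5 = 0 ∧
      ((⟨1, 0, 1, -5, 0⟩ : WeierstrassCurve ℤ).map (Int.castRingHom ℚ)).mordellWeilRank = 2 ∧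
      (((⟨1, 0, 1, -5, 0⟩ : WeierstrassCurve ℤ).map (Int.castRingHom ℚ)).quadraticTwist
        ((-7 : ℤ) : ℚ)).mordellWeilRank = 1 ∧
      (((⟨1, 0, 1, -5, 0⟩ : WeierstrassCurve ℤ).map (Int.castRingHom ℚ)).quadraticTwist
        ((-7 : ℤ) : ℚ)).shaCorank 5 = 0 := by
  haveI := isElliptic_c718b1
  haveI := isGloballyMinimal_c718b1
  haveI : NeZero (((⟨1, 0, 1, -5, 0⟩ : WeierstrassCurve ℤ).map (Int.castRingHom ℚ)).conductorNorm ℤ) :=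
    neZero_conductorNorm_of_isElliptic _
  intro Dt β ι d hσ hS₁ hS₂ hemb hne htw
  haveI := Fact.mk (by norm_num : Nat.Prime 5)
  exact depthRow_of_print_of_intModel_certificate intModel h54 h43 h44 h53 h22 not_hasCM
    KernelCerts002.C718b1.two_le_rank 5 (by norm_num) hasSurjectiveModNGaloisRep_pow_5 K hK hD
    (by norm_num) (by norm_num) heegner_neg7 59 (by norm_num) (by norm_num) (by decide +kernel)
    (by norm_num) (by norm_num) (by norm_num) (by norm_num) (n := 55) card_59 (by norm_num) Dt β ι
    d hσ hS₁ hS₂ hemb hne htw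

end C718b1

end Summit.BirchSwinnertonDyer.BirchSwinnertonDyer.Theorems.KolyvaginDepthDoor

end
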